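import Summits.QuantumFields.QCD.Theses.EulerDescent
import Literature.MathematicalPhysics.QuantumFieldTheory.QCDCurrentSector
import Summits.QuantumFields.QCD.Theorems.EulerDescentChiralCornerSoftnessStubSlabFluxBound
import Summits.QuantumFields.QCD.Theorems.EulerDescentChiralCornerSoftnessStubCondensateFluxFloorNondegTwo
import Summits.QuantumFields.QCD.Theorems.EulerDescentChiralCornerSoftnessStubCondensateFluxFloorRayZerosFinite
import Literature.MathematicalPhysics.QuantumFieldTheory.QCDPhaseQuenchedPositivity
import Literature.MathematicalPhysics.QuantumLattice.GrassmannGaussianSourceDerivative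
import HarnessLib

/-!
# Sub-goal `stub_condensateFluxFloor_smallTwistLimit` of line `Sketch`
(crux `Summit.QuantumFields.QCD.Theses.EulerDescent.ChiralCornerSoftness`, item stmt-QuantumFields-16902)

**At fixed inverse coupling, pin, slope and torus the slab flux of the twisted doublet vanishes in the
small-twist limit (`N_f = 2`).**  For the twisted-mass Wilson doublet `(f, g)`, `f ≠ g` in `Fin 2`, at fixed
`β`, pin `mc`, slope `c`, torus side `2S+1` and slab `1 ≤ s₀ ≤ S`, the slab flux
`Φ(t) = Σ_{y⃗} ⟨(Ṽ²₀(s₀−1,y⃗) − Ṽ²₀(−s₀,y⃗)) P¹(0)⟩_{(m₀, μ) = (mc + ct, ct)}` of the conserved flavour current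
through the two slices bounding the slab complement tends to `0` as the ray parameter `t → 0`
(`stub_condensateFluxFloor_smallTwistLimit`, the registered signature).  This is the disprover's near-miss
made concrete: a condensate FLOOR on the flux with the ray parameter innermost is impossible at fixed
`(β, S)`.

## Proof (everything is proved; no named fact is taken as a hypothesis)

* `SlabFluxWard.slabFlux_eq` (E1) — the exact PCVC identity `Φ(t) = −2(ct) · Σ_{s ∈ slab} Σ_{y⃗} N_{s,y⃗}(t) / Z(t)`
  with `N`, `Z` the gauge averages of the Berezin integrals of `P¹(0)P¹(s,y⃗) e^{−ψ̄M_t(U)ψ}`, `e^{−ψ̄M_t(U)ψ}`,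
  `M_t(U) = D_W(U, mc + ct) ⊗ 1 + i(ct)γ₅ ⊗ τ³`.
* `SmallTwist.fermiIntegral_mul_grassmannExp_ray_eq_sum` — the ray matrix is affine, `M_t(U) = A(U) + (ct)·B`
  (`RayZeros.exists_slope`), the quadratic action is additive and central, `e^{−ψ̄(A + sB)ψ} = e^{−ψ̄Aψ} e^{s·q}`,
  `q = −ψ̄Bψ` nilpotent (`grassmannExp_quadratic_add`, `isNilpotent_quadratic`), so at FIXED gauge field
  `∫dψ̄dψ X e^{−ψ̄(A + sB)ψ} = Σ_{i<K} sⁱ/i! ∫dψ̄dψ X e^{−ψ̄Aψ} qⁱ` is a polynomial in `s`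
  (`apply_mul_grassmannExp_smul_eq_sum`, Berezin 1966 Ch. I §3 / Montvay–Münster §4.1: the Gaussian Grassmann
  integral with insertions is a polynomial in the couplings).
* `SmallTwist.continuous_integral_fermiIntegral_mul_twWeight_ray` — every coefficient
  `U ↦ ∫dψ̄dψ X(U) e^{−ψ̄A(U)ψ} qⁱ` is coefficient-regular (`coeffRegular_quadratic`, `CoeffRegular.mul`), hence
  integrable over the Wilson probability measure (`SlabFluxWard.integrable_fermiIntegral`); the Bochner integral
  commutes with the finite sum, so `t ↦ ∫dμ_W N_t` is a polynomial, in particular continuous, in `t`.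
* `SmallTwist.twDenominator_two_zero_ne_zero` — at `t = 0` the twist vanishes (`SmallTwist.twistQ_zero`) and for
  `N_f = 2` degenerate flavours the Berezin weight is `det(D_W + mc)² = |det D(U)| ≥ 0`
  (`NondegTwo.fermiIntegral_grassmannExp_quadratic_neg`, `det_diracMatrix`, reality of the Wilson determinant),
  so `Z(0) = ∫ |det D| dμ_W > 0` (`integral_norm_det_diracMatrix_pos_all`).
* Hence `N_{s,y⃗}(t)/Z(t) → N_{s,y⃗}(0)/Z(0)` (`Filter.Tendsto.div`), the finite sums converge, and the prefactor
  `−2ct → 0` kills the limit (`Filter.Tendsto.mul`).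

References: R. Frezzotti, P. A. Grassi, S. Sint, P. Weisz, JHEP 08 (2001) 058, §2.1 (twisted-mass lattice QCD and
the PCVC relation); I. Montvay, G. Münster, *Quantum Fields on a Lattice* (CUP 1994), §4.1.3 (4.17)–(4.22)
(Gaussian Grassmann integrals are polynomials in the couplings), §5.1.2 (5.16) (reality of the Wilson
determinant); F. A. Berezin, *The Method of Second Quantization* (1966), Ch. I §3.
-/

noncomputable section

namespace Summit.QuantumFields.QCD.Cruxes.ChiralCornerSoftness.TwistedRay

open Filter Topology MeasureTheory
open Literature.MathematicalPhysics.QuantumFieldTheory Literature.MathematicalPhysics.QuantumLattice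
  Literature.Probability.LatticeModels

namespace SmallTwist

open SlabFluxWard NondegTwo RayZeros
open Literature.MathematicalPhysics.QuantumLattice.GrassmannAlgebra

/-! ### The Berezin integral with insertions on the ray is a polynomial in the ray parameter -/

section Ray

variable {Nf L : ℕ}

/-- At zero twisted mass the twist matrix `iμγ₅τ³` vanishes. [folklore] -/
theorem twistQ_zero (f g : Fin Nf) : twistQ (L := L) f g 0 = 0 := by
  ext v w
  simp [twistQ]

/-- **Expansion in the ray parameter at fixed gauge field.**  For the affine pencil `A + s·B` and any
insertion `X`, `∫dψ̄dψ X e^{−ψ̄(A + sB)ψ} = Σ_{i<K} (sⁱ/i!) ∫dψ̄dψ X e^{−ψ̄Aψ} qⁱ` with `q = −ψ̄Bψ`, `q^K = 0`: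
the quadratic actions are central and nilpotent, `e^{−ψ̄(A+sB)ψ} = e^{−ψ̄Aψ} e^{s q}`, and the exponential
series of `s q` stops. [cite: MontvayMunster1994, §4.1.3 (4.17)–(4.22)] -/
theorem fermiIntegral_mul_grassmannExp_ray_eq_sum [NeZero L] {B : Matrix (FermiIdx Nf L) (FermiIdx Nf L) ℂ}
    {K : ℕ} (hK : quadratic ℂ (-B) ^ K = 0) (X : FermiAlg Nf L) (A : Matrix (FermiIdx Nf L) (FermiIdx Nf L) ℂ)
    (s : ℂ) :
    fermiIntegral (X * grassmannExp (quadratic ℂ (-(A + s • B)))) =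
      ∑ i ∈ Finset.range K, (i.factorial : ℂ)⁻¹ * s ^ i *
        fermiIntegral (X * grassmannExp (quadratic ℂ (-A)) * quadratic ℂ (-B) ^ i) := by
  rw [neg_add, ← smul_neg, grassmannExp_quadratic_add, quadratic_smul, ← mul_assoc]
  exact apply_mul_grassmannExp_smul_eq_sum fermiIntegral _ hK s

/-- **The gauge average of an inserted Berezin integral is continuous along the twisted ray.**  For a
coefficient-regular insertion `X(U)`, the un-normalised functional
`t ↦ ∫dμ_W(U) ∫dψ̄dψ X(U) e^{−ψ̄(D_W(U, mc + ct) ⊗ 1 + i(ct)γ₅ ⊗ τ³)ψ}` is a polynomial in `t` — the ray matrix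
is `A(U) + (ct)·B` (`RayZeros.exists_slope`), the fixed-`U` expansion has coefficient-regular, hence integrable,
coefficients `U ↦ ∫dψ̄dψ X(U) e^{−ψ̄A(U)ψ} qⁱ`, and the Bochner integral commutes with the finite sum — in
particular it is continuous in `t`. [cite: MontvayMunster1994, §4.1.3 (4.17)–(4.22)] -/
theorem continuous_integral_fermiIntegral_mul_twWeight_ray {S : ℕ} (f g : Fin Nf) (β mc c : ℝ)
    {X : GaugeConfig 4 (2 * S + 1) (Matrix.specialUnitaryGroup (Fin 3) ℂ) → FermiAlg Nf (2 * S + 1)}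
    (hX : CoeffRegular X) :
    Continuous fun t : ℝ => ∫ U, fermiIntegral (X U * grassmannExp (quadratic ℂ
      (-(diracMatrix U (fun _ : Fin Nf => mc + c * t) + Matrix.reindex quarkEquiv quarkEquiv (twistQ f g (c * t))))))
      ∂(wilsonMeasure (d := 4) (L := 2 * S + 1) (fundamentalRep (Fin 3)) β) := by
  obtain ⟨B, -, hray⟩ := exists_slope (L := 2 * S + 1) f g mc
  obtain ⟨K, hK⟩ := isNilpotent_quadratic ℂ (-B)
  -- the coefficient variables `U ↦ X(U) e^{−ψ̄A(U)ψ} qⁱ` are regular, hence integrable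
  have hA : CoeffRegular fun U : GaugeConfig 4 (2 * S + 1) (Matrix.specialUnitaryGroup (Fin 3) ℂ) =>
      grassmannExp (quadratic ℂ (-diracMatrix U (fun _ : Fin Nf => mc))) :=
    (coeffRegular_quadratic fun p q => (continuous_diracMatrix _).neg.matrix_elem p q).grassmannExp
      fun U => coord_empty_quadratic _
  have hG : ∀ i : ℕ, Integrable (fun U => fermiIntegral (X U *
      grassmannExp (quadratic ℂ (-diracMatrix U (fun _ : Fin Nf => mc))) * quadratic ℂ (-B) ^ i))
        (wilsonMeasure (d := 4) (L := 2 * S + 1) (fundamentalRep (Fin 3)) β) := fun i =>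
    integrable_fermiIntegral ((hX.mul hA).mul (coeffRegular_const _)) _
  -- the functional is the polynomial `Σ_i (ct)ⁱ/i! ∫ (coefficient i)`
  have key : ∀ t : ℝ, (∫ U, fermiIntegral (X U * grassmannExp (quadratic ℂ
      (-(diracMatrix U (fun _ : Fin Nf => mc + c * t) + Matrix.reindex quarkEquiv quarkEquiv (twistQ f g (c * t))))))
        ∂(wilsonMeasure (d := 4) (L := 2 * S + 1) (fundamentalRep (Fin 3)) β)) =
      ∑ i ∈ Finset.range K, (i.factorial : ℂ)⁻¹ * ((c * t : ℝ) : ℂ) ^ i *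
        ∫ U, fermiIntegral (X U * grassmannExp (quadratic ℂ (-diracMatrix U (fun _ : Fin Nf => mc))) *
          quadratic ℂ (-B) ^ i) ∂(wilsonMeasure (d := 4) (L := 2 * S + 1) (fundamentalRep (Fin 3)) β) := fun t => by
    simp_rw [hray, fermiIntegral_mul_grassmannExp_ray_eq_sum hK]
    rw [integral_finsetSum _ fun i _ => (hG i).const_mul _]
    exact Finset.sum_congr rfl fun i _ => integral_const_mul _ _
  have hct : Continuous fun t : ℝ => ((c * t : ℝ) : ℂ) :=
    Complex.continuous_ofReal.comp (continuous_const.mul continuous_id)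
  refine (continuous_finsetSum (Finset.range K) fun i _ => ?_).congr fun t => (key t).symm
  exact (continuous_const.mul (hct.pow i)).mul continuous_const

end Ray

/-! ### `N_f = 2`: the zero-twist denominator is `∫ |det D| dμ_W > 0` -/

section Two

variable {L : ℕ} [NeZero L]

/-- **For two degenerate Wilson flavours the fermion determinant is `|det D| ≥ 0`**:
`det(D_W(U,m) ⊗ 1₂) = det D_W(U,m)²` with `det D_W(U,m)` real (`γ₅`-Hermiticity), so it equals its own modulus.
[cite: MontvayMunster1994, §5.1.2 (5.16)] -/
theorem det_diracMatrix_two_eq_norm (U : GaugeConfig 4 L (Matrix.specialUnitaryGroup (Fin 3) ℂ)) (mc : ℝ) :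
    (diracMatrix U (fun _ : Fin 2 => mc)).det = ((‖(diracMatrix U (fun _ : Fin 2 => mc)).det‖ : ℝ) : ℂ) := by
  have hre : 0 ≤ ((diracMatrix U (fun _ : Fin 2 => mc)).det).re := by
    have him : (fermionDet (wilsonDirac (fundamentalRep (Fin 3)) U mc 1)).im = 0 :=
      fermionDet_wilsonDirac_im_holds (L := L) (fundamentalRep (Fin 3)) (fun g => fundamentalRep_mem_unitaryGroup g)
        U mc 1
    rw [det_diracMatrix, Fin.prod_univ_two, Complex.mul_re, him, mul_zero, sub_zero]
    exact mul_self_nonneg _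
  rw [norm_det_diracMatrix_eq_abs_re, abs_of_nonneg hre]
  exact det_diracMatrix_eq_ofReal_re U _

/-- **The zero-twist `N_f = 2` Berezin weight is `|det D(U)|`** (orientation sign `+1`,
`NondegTwo.fermiIntegral_grassmannExp_quadratic_neg`). [cite: MontvayMunster1994, §4.1.3 (4.17)–(4.22)] -/
theorem fermiIntegral_weight_two_zero (U : GaugeConfig 4 L (Matrix.specialUnitaryGroup (Fin 3) ℂ)) (mc : ℝ) :
    fermiIntegral (grassmannExp (quadratic ℂ (-diracMatrix U (fun _ : Fin 2 => mc)))) =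
      ((‖(diracMatrix U (fun _ : Fin 2 => mc)).det‖ : ℝ) : ℂ) := by
  rw [fermiIntegral_grassmannExp_quadratic_neg]
  exact det_diracMatrix_two_eq_norm U mc

/-- **The zero-twist `N_f = 2` denominator is nonzero**: `Z(0) = ∫ |det D(U)| dμ_W(U) > 0` — the Wilson
measure charges the open set where the continuous `|det D|` is positive (`integral_norm_det_diracMatrix_pos_all`).
[folklore] -/
theorem twDenominator_two_zero_ne_zero (f g : Fin 2) (β mc : ℝ) (S : ℕ) :
    (∫ U, fermiIntegral (grassmannExp (quadratic ℂ (-(diracMatrix U (fun _ : Fin 2 => mc) +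
          Matrix.reindex quarkEquiv quarkEquiv (twistQ f g 0)))))
        ∂(wilsonMeasure (d := 4) (L := 2 * S + 1) (fundamentalRep (Fin 3)) β)) ≠ 0 := by
  have h0 : Matrix.reindex (quarkEquiv (Nf := 2) (L := 2 * S + 1)) quarkEquiv (twistQ f g 0) = 0 := by
    rw [twistQ_zero]
    simp
  simp only [h0, add_zero, fermiIntegral_weight_two_zero]
  rw [integral_complex_ofReal, Complex.ofReal_ne_zero]
  exact (integral_norm_det_diracMatrix_pos_all β _).ne'

/-- **The slab flux on the twisted ray tends to zero with the ray parameter** (`N_f = 2`, fixed `β`, `mc`, `c`,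
`S`, `1 ≤ s₀ ≤ S`; stated with `SlabFluxWard.tau1M/tau2M/twistQ`, verbatim the bodies of the skeleton's
`τ1/τ2/Tw`): by the slab flux identity `Φ(t) = −2(ct) Σ_s Σ_{y⃗} N_{s,y⃗}(t)/Z(t)` with `N`, `Z` continuous in `t`
and `Z(0) ≠ 0`. [cite: FrezzottiGrassiSintWeisz2001, §2.1] -/
theorem slabFlux_ray_tendsto_zero {S : ℕ} {f g : Fin 2} (hfg : f ≠ g) (β mc c : ℝ) {s₀ : ℕ}
    (hs₀ : 1 ≤ s₀) (hsS : s₀ ≤ S) :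
    Tendsto (fun t : ℝ => ∑ y ∈ box 3 S,
        (∫ U, fermiIntegral
            (((conservedVectorCurrent 2 (tau2M f g) 0).onTorus (2 * S + 1) (Matrix.vecCons ((s₀ : ℤ) - 1) y) U -
                  (conservedVectorCurrent 2 (tau2M f g) 0).onTorus (2 * S + 1) (Matrix.vecCons (-(s₀ : ℤ)) y) U) *
                (pseudoscalarDensityObs 2 (tau1M f g)).onTorus (2 * S + 1) 0 U *
              grassmannExp (quadratic ℂ (-(diracMatrix U (fun _ : Fin 2 => mc + c * t) +
                Matrix.reindex quarkEquiv quarkEquiv (twistQ f g (c * t))))))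
          ∂(wilsonMeasure (d := 4) (L := 2 * S + 1) (fundamentalRep (Fin 3)) β)) /
        (∫ U, fermiIntegral (grassmannExp (quadratic ℂ (-(diracMatrix U (fun _ : Fin 2 => mc + c * t) +
            Matrix.reindex quarkEquiv quarkEquiv (twistQ f g (c * t))))))
          ∂(wilsonMeasure (d := 4) (L := 2 * S + 1) (fundamentalRep (Fin 3)) β)))
      (𝓝 0) (𝓝 0) := by
  refine Tendsto.congr (fun t => (slabFlux_eq hfg hs₀ hsS β (mc + c * t) (c * t)).symm) ?_
  have hP := fun v => coeffRegular_onTorus (L := 2 * S + 1) (pseudoscalarDensityObs 2 (tau1M f g)) v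
  -- numerators and denominator are continuous in the ray parameter
  have hN : ∀ (s : ℕ) (y : Literature.Probability.LatticeModels.Site 3), Continuous fun t : ℝ =>
      ∫ U, fermiIntegral
        ((pseudoscalarDensityObs 2 (tau1M f g)).onTorus (2 * S + 1) 0 U *
            (pseudoscalarDensityObs 2 (tau1M f g)).onTorus (2 * S + 1) (Matrix.vecCons (s : ℤ) y) U *
          grassmannExp (quadratic ℂ (-(diracMatrix U (fun _ : Fin 2 => mc + c * t) +
            Matrix.reindex quarkEquiv quarkEquiv (twistQ f g (c * t))))))
        ∂(wilsonMeasure (d := 4) (L := 2 * S + 1) (fundamentalRep (Fin 3)) β) := fun s y =>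
    continuous_integral_fermiIntegral_mul_twWeight_ray f g β mc c ((hP 0).mul (hP _))
  have hZ : Continuous fun t : ℝ =>
      ∫ U, fermiIntegral (grassmannExp (quadratic ℂ (-(diracMatrix U (fun _ : Fin 2 => mc + c * t) +
          Matrix.reindex quarkEquiv quarkEquiv (twistQ f g (c * t))))))
        ∂(wilsonMeasure (d := 4) (L := 2 * S + 1) (fundamentalRep (Fin 3)) β) := by
    obtain ⟨Q, -, hQ⟩ := exists_rayPoly β mc f g S
    simp only [hQ]
    exact Q.continuous.comp (Complex.continuous_ofReal.comp (continuous_const.mul continuous_id))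
  have hZ0 : (∫ U, fermiIntegral (grassmannExp (quadratic ℂ (-(diracMatrix U (fun _ : Fin 2 => mc + c * 0) +
          Matrix.reindex quarkEquiv quarkEquiv (twistQ f g (c * 0))))))
        ∂(wilsonMeasure (d := 4) (L := 2 * S + 1) (fundamentalRep (Fin 3)) β)) ≠ 0 := by
    rw [mul_zero, add_zero]
    exact twDenominator_two_zero_ne_zero f g β mc S
  have hlim := tendsto_finsetSum ((Finset.range (2 * S + 2)).filter (fun s => s₀ ≤ s ∧ s + s₀ ≤ 2 * S + 1))
    fun s _ => tendsto_finsetSum (box 3 S) fun y _ => ((hN s y).tendsto 0).div (hZ.tendsto 0) hZ0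
  -- the prefactor `−2ct → 0`
  have h0 : Tendsto (fun t : ℝ => -(2 * ((c * t : ℝ) : ℂ))) (𝓝 0) (𝓝 0) := by
    have hc : Continuous fun t : ℝ => -(2 * ((c * t : ℝ) : ℂ)) :=
      (continuous_const.mul (Complex.continuous_ofReal.comp (continuous_const.mul continuous_id))).neg
    have h := hc.tendsto 0
    rwa [mul_zero, Complex.ofReal_zero, mul_zero, neg_zero] at h
  simpa only [zero_mul, Pi.div_apply] using h0.mul hlim

end Two

end SmallTwist

open SmallTwist in
/-- **Registered sub-goal `stub_condensateFluxFloor_smallTwistLimit` of line `Sketch`: at fixed `(β, mc, c, S, s₀)`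
the slab flux of the `N_f = 2` twisted doublet vanishes as the ray parameter `t → 0`.**  For `f ≠ g` in `Fin 2`,
every `β`, pin `mc`, slope `c`, torus side `2S+1` and slab `1 ≤ s₀ ≤ S`, the flux
`Φ(t) = Σ_{y⃗} ⟨(Ṽ²₀(s₀−1,y⃗) − Ṽ²₀(−s₀,y⃗)) P¹(0)⟩` at the bare point `(mc + ct, ct)` of the twisted ray satisfies
`Φ(t) → 0` (`t → 0`, two-sided): the exact PCVC identity gives `Φ(t) = −2(ct) Σ_{s ∈ slab} Σ_{y⃗} N_{s,y⃗}(t)/Z(t)`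
(`SlabFluxWard.slabFlux_eq`); `N`, `Z` are gauge averages of Berezin integrals whose matrix is affine in `t`,
hence polynomials in `t` (`SmallTwist.continuous_integral_fermiIntegral_mul_twWeight_ray`); and
`Z(0) = ∫ |det D(U)| dμ_W > 0` for two degenerate flavours (`SmallTwist.twDenominator_two_zero_ne_zero`).  So
the open input E3 (`stub_condensateFluxFloor`) cannot be strengthened to a floor with `t` innermost.
The `let`s are textually the skeleton's. [cite: FrezzottiGrassiSintWeisz2001, §2.1] -/
theorem stub_condensateFluxFloor_smallTwistLimit : ∀ (Nf : ℕ), Nf = 2 → ∀ (f g : Fin Nf), f ≠ g → ∀ (β mc c : ℝ) (S s₀ : ℕ), 1 ≤ s₀ → s₀ ≤ S → let τ1 : Matrix (Fin Nf) (Fin Nf) ℂ := Matrix.single f g 1 + Matrix.single g f 1; let τ2 : Matrix (Fin Nf) (Fin Nf) ℂ := (-Complex.I) • Matrix.single f g 1 + Complex.I • Matrix.single g f 1; let P1 : QCDLatticeObservable Nf 1 := pseudoscalarDensityObs Nf τ1; let V2 : QCDLatticeObservable Nf 1 := conservedVectorCurrent Nf τ2 0; let Tw := fun (S : ℕ) (μl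 : ℝ) => Matrix.reindex (quarkEquiv (Nf := Nf) (L := 2 * S + 1)) quarkEquiv (Matrix.of fun v w : QuarkVar Nf (2 * S + 1) => if v.1 = w.1 ∧ v.2.1 = w.2.1 ∧ v.2.2.1 = w.2.2.1 then (if v.1 = f then (1 : ℂ) else if v.1 = g then -1 else 0) * ((μl : ℂ) * Complex.I) * gammaFive v.2.2.2 w.2.2.2 else 0); let E := fun (β m₀ μl : ℝ) (S : ℕ) (X : GaugeConfig 4 (2 * S + 1) (Matrix.specialUnitaryGroup (Fin 3) ℂ) → FermiAlg Nf (2 * S + 1)) => (∫ U, fermiIntegral (X U * grassmannExp (quadratic ℂ (-(diracMatrix U (fun _ : Fin Nf => m₀) + Tw S μl)))) ∂(wilsonMeasure (d := 4) (L := 2 * S + 1) (fundamentalRep (Fin 3)) β)) / (∫ U, fermiIntegral (grassmannExp (quadratic ℂ (-(diracMatrix U (fun _ : Fin Nf => m₀) + Tw S μl)))) ∂(wilsonMeasure (d := 4) (L := 2 * S + 1) (fundamentalRep (Fin 3)) β)); let Φ := fun (β m₀ μl : ℝ) (S : ℕ) (s₀ : ℕ) => ∑ y ∈ box 3 S, E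 β m₀ μl S (fun U => (V2.onTorus (2 * S + 1) (Matrix.vecCons ((s₀ : ℤ) - 1) y) U - V2.onTorus (2 * S + 1) (Matrix.vecCons (-(s₀ : ℤ)) y) U) * P1.onTorus (2 * S + 1) 0 U); Filter.Tendsto (fun t : ℝ => Φ β (mc + c * t) (c * t) S s₀) (nhds 0) (nhds 0) := by
  intro Nf hNf f g hfg β mc c S s₀ hs₀ hsS
  dsimp only
  subst hNf
  exact slabFlux_ray_tendsto_zero hfg β mc c hs₀ hsS

end Summit.QuantumFields.QCD.Cruxes.ChiralCornerSoftness.TwistedRay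

end
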